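/-
Origin: expansion seat `planner-pub-hodgecm-pv13-0`, handover 2026-08-18T03:36:49Z (`HOME/pub-hodgecm-pv13/lean/Pv13/EulerProductProof.lean`, md5 a6e144c9, 551 lines);
landed by the gen-5 packager in gate run 19 as `HodgeCM/PerL34/EulerProduct.lean` (import ^import Pv[0-9]+\.→import HodgeCM.PerL34. ×1).
-/
/-
Origin: HOME/pub-hodgecm-pv13/lean/Pv13/EulerProductProof.lean — session planner-pub-hodgecm-pv13-0
(unit pub-hodgecm-pv13, DAG-NODE PROVER #13 of 15), node **N31h** of HOME/LEMMAS.md (carver v1 2026-08-18T03:25Z).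
WIP module name `Pv13.EulerProductProof`; intended final place `HodgeCM/PerL34/EulerProductProof.lean`
(packager: `sed 's/^import Pv13\./import HodgeCM.PerL34./'`; the carver's own N31 typing lives in
`HodgeCM/PerL34/Chars.lean` — no file-name collision).  Imports `Mathlib.*` / `HodgeCM.*` (+ this seat's
`Pv13.EulerProductPlaces` → `HodgeCM.PerL34.EulerProductPlaces`) only.  Nothing is asserted: every hypothesis is an
explicit binder or structure field, listed under `## Inputs`.
-/
import Summits.HodgeConjecture.HodgeCM.Prior.Perl34_5
import Summits.HodgeConjecture.HodgeCM.PerL34.EulerProductPlaces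
import Mathlib.Analysis.SpecialFunctions.Pow.Real
import Mathlib.Topology.Algebra.InfiniteSum.Real

set_option autoImplicit false

/-!
# N31h — PerL v5 Lemma 4.2(b), end of proof (tex ll. 631–635): the Euler product

VERBATIM (PerL v5 = `inputs/2001/…pmqp-galois-closure-y1__paper-v5-d912a121.tex`, ll. 631–635; checked against
`HOME/LEMMAS.md` §5 block N31h, identical):

> 631: … $|a_v|=1$ (measures giving the maximal compact subgroups volume $1$). Hence $\prod_vI_v(\phi_v)$ converges
>      absolutely to a positive number for suitable $\phi$, so $\langle\theta_\phi(\chi'),\theta_\phi(\chi')\rangle>0$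
> 632: and $\pi_i\ne0$. Finally, $\pi_i$ is generated by the $\theta(\phi,\chi'_i)$ with $\phi_b$ in
> 633: the isotypic parts singled out in (a), which realise $J^+$ at $\iota_1$ and $\mathbf 1$ at $b\ne\iota_1$ as
>      $(\fg_b,K_b)$-modules
> 634: \cite[Lemmas 3.1, 3.2]{Y1neg}; so every irreducible constituent of the closure of $\pi_i$ has archimedean
>      component $J^+\otimes
> 635: \mathbf 1^{\otimes}$, i.e.\ lies in $\cA^{1,0}$.

The node has two halves.

**(i) ANALYTIC HALF (ll. 631–632), PROVED HERE (kind L1) from the outputs of the upstream nodes as hypotheses:**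
given the local factors `I_v ∈ ℝ` of the chosen factorizable `φ = ⊗ φ_v` (N31f, l. 609), a finite set `S` of
places with `I_v > 0` for `v ∈ S` (N31f, ll. 612–623), and outside `S` the unramified values of N31g (ll. 628–631)
`I_v = 1` (non-split) resp. `I_v = Σ_{n∈ℤ} q_v^{−3|n|/2} a_vⁿ` (split), `a_v = χ'_v(ϖ_v) ν_v(ϖ_v)` with `χ'_v`, `ν_v`
unitary, `q_v ≥ 2`, and the convergence `Σ_{v∉S} q_v^{−3/2} < ∞` (Dedekind-zeta comparison; see `## Inputs` below),
we PROVE: `|a_v| = 1`; every factor is `> 0`; `Σ_v |log I_v| < ∞` AND `Σ_v |I_v − 1| < ∞` (the product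
converges ABSOLUTELY); `HasProd I P` with `P = (∏_{v∈S} I_v) · exp(Σ_{v∉S} log I_v) > 0`, `Multipliable I`,
`0 < ∏' v, I v`; and hence, from the Rallis inner product formula in the form delivered by N31e/N31f
(`⟨θ_φ(χ'),θ_φ(χ')⟩ = c · vol([U(W_i)]) · ∏_v I_v(φ_v)`, `c > 0`: Weil's Siegel–Weil constant, N31d),
`⟨θ_φ(χ'),θ_φ(χ')⟩ > 0`, `θ_φ(χ') ≠ 0`, and `π_i ≠ 0` (`π_i` = the span of the theta lifts contains `θ_φ(χ') ≠ 0`).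
Compared with the prior programme's frozen interface `Perl34.C4.RallisDatum` (package file
`HodgeCM/Prior/Perl34.lean` ll. 1174–1271, whose proved lemmas `eulerFactor`, `hasSum_eulerFactor`,
`abs_log_eulerFactor_le`, `hasProd_of_summable_log`, … are REUSED here), five of its posited fields become theorems:
`tail` / `AX7_tail` (existence of the tail product is DERIVED, not assumed), `tpar_nonneg` / `tpar_le`
(from `q_v ≥ 2`), `apar_norm` (from unitarity); see `LocalFactorDatum.toRallisDatum`.

**(ii) CONSTITUENT HALF (ll. 632–635), NOT provable in the package today (no `(𝔤,K)`-module / automorphic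
vocabulary; LEMMAS.md §3 D2, D4, D5) and resting on `[Y1neg]` Lemmas 3.1/3.2, which the cell's ABSOLUTE RULE makes
NON-citable.**  It is recorded as the typed residual `ConstituentHalf` below (honest L2 split: `analyticHalf`
PROVED for every character + `ConstituentHalf` residual ⇒ `charsDischargeOf` / `allowed_of_localFactorData`, the
N31h share of the carver's `N31_split`) and as a GAPS.md entry (node N31h, sub-step (ii)) naming the print
re-sourcing that would close it (Kashiwara–Vergne, Invent. Math. 44 (1978) 1–47, the `K`-type / lowest-weight
structure of the Fock model of the pairs `(U(p,q),U(1))`; Adams, *The theta correspondence over ℝ*, 2007; Howe,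
JAMS 2 (1989) 535–552) plus the elementary representation-theoretic fact "a `(𝔤_∞,K_∞) × G(𝔸_f)`-module generated by
vectors lying in `τ`-isotypic irreducible archimedean submodules has all constituents of its `L²`-closure with
archimedean component `τ`" (discrete decomposition of `L²([G_U])`, `[G_U]` compact).

## Inputs of the analytic half and their status
* `ram_pos` (N31f, ll. 612–623: `I_v > 0` for `v ∈ S`) — upstream node, hypothesis here.
* `split_val`, `nonsplit_val` (N31g, ll. 623–631) — upstream node, hypothesis here.
* `two_le_q` (`q_v ≥ 2`: size of a residue field), `chi_norm`, `nu_norm` (values of unitary characters have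
  absolute value 1) — definitional properties of the intended objects, hypotheses on the abstract datum.
* `summable_t` (`Σ_{v∉S} q_v^{−3/2} < ∞`) and `two_le_q` — PROVED for the finite places of any number field in the
  companion file `EulerProductPlaces.lean` (`NumberField.summable_absNorm_rpow`: `Σ_v N(v)^r < ∞` for `r < −1`,
  via `Ideal.card_primesOverFinset_le_finrank` + `Int.absNorm_under_dvd_absNorm` + `Real.summable_nat_rpow`) and
  transported to the abstract index type here (`summable_tOf_of_places`, `two_le_of_places`): they are fields of
  the abstract datum only so that `V` may be ANY indexing of the places (the archimedean ones sit in `S`).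
* `rallis` (N31e + first sentence of N31f, ll. 588–609: `⟨θ_φ(χ'),θ_φ(χ')⟩ = c · vol · ∏_v I_v(φ_v)`; PRINT heart:
  J.-S. Li, J. reine angew. Math. 428 (1992) Thm 2.1 with (26)–(27); Weil 1965 Thm 5) — upstream nodes.
-/

noncomputable section

namespace HodgeCM

namespace PerL34

namespace EulerProduct

open HodgeCM.Prior.Perl34File
open HodgeCM.Prior.Perl34File.Perl34.C4
open scoped InnerProductSpace

variable {V : Type}

/-! ### The parameters `t_v = q_v^{−3/2}` and `a_v = χ'_v(ϖ_v) ν_v(ϖ_v)` (tex ll. 629–631) -/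

/-- `t_v := q_v^{−3/2}` (so that `q_v^{−3|n|/2} = t_v^{|n|}`, l. 629–630). -/
def tOf (q : ℕ) : ℝ := (q : ℝ) ^ (-(3 / 2 : ℝ))

/-- (Ported verbatim from the HodgeCMPerL package; no docstring in the source.) -/
theorem tOf_nonneg (q : ℕ) : 0 ≤ tOf q := Real.rpow_nonneg (Nat.cast_nonneg q) _

/-- (Ported verbatim from the HodgeCMPerL package; no docstring in the source.) -/
theorem tOf_eq_inv (q : ℕ) : tOf q = ((q : ℝ) ^ (3 / 2 : ℝ))⁻¹ := by
  unfold tOf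
  rw [Real.rpow_neg (Nat.cast_nonneg q)]

/-- `q_v ≥ 2 ⇒ t_v ≤ 2^{−3/2} ≤ 1/2`. -/
theorem tOf_le_half {q : ℕ} (hq : 2 ≤ q) : tOf q ≤ 1 / 2 := by
  have hq' : (2 : ℝ) ≤ q := by exact_mod_cast hq
  have h1 : (2 : ℝ) ≤ (q : ℝ) ^ (3 / 2 : ℝ) :=
    calc (2 : ℝ) = 2 ^ (1 : ℝ) := (Real.rpow_one 2).symm
      _ ≤ 2 ^ (3 / 2 : ℝ) := Real.rpow_le_rpow_of_exponent_le (by norm_num) (by norm_num)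
      _ ≤ (q : ℝ) ^ (3 / 2 : ℝ) := Real.rpow_le_rpow (by norm_num) hq' (by norm_num)
  rw [tOf_eq_inv, inv_eq_one_div]
  exact one_div_le_one_div_of_le (by norm_num) h1

/-- (Ported verbatim from the HodgeCMPerL package; no docstring in the source.) -/
theorem tOf_lt_one {q : ℕ} (hq : 2 ≤ q) : tOf q < 1 := by
  have := tOf_le_half hq
  linarith

/-- `|a_v| = |χ'_v(ϖ_v)| · |ν_v(ϖ_v)| = 1` (l. 630–631: "`χ'_v`, `ν_v` unitary, `|a_v| = 1`"). -/
theorem norm_mul_eq_one {x y : ℂ} (hx : ‖x‖ = 1) (hy : ‖y‖ = 1) : ‖x * y‖ = 1 := by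
  rw [norm_mul, hx, hy, mul_one]

/-! ### The split unramified factor: `|I_v − 1| ≤ 4 t_v` (for the classical form of absolute convergence) -/

/-- Two-sided bounds `(1−t)/(1+t) ≤ (1−t²)/|1−at|² ≤ (1+t)/(1−t)` (`|a| = 1`, `0 ≤ t < 1`). -/
theorem eulerFactor_bounds {t : ℝ} (ht0 : 0 ≤ t) (ht1 : t < 1) {a : ℂ} (ha : ‖a‖ = 1) :
    (1 - t) / (1 + t) ≤ eulerFactor t a ∧ eulerFactor t a ≤ (1 + t) / (1 - t) := by
  have h1t : (0 : ℝ) < 1 - t := by linarith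
  have h1t' : (0 : ℝ) < 1 + t := by linarith
  have hat : ‖a * (t : ℂ)‖ = t := norm_mul_ofReal ha ht0
  have hlo : 1 - t ≤ ‖(1 : ℂ) - a * t‖ := by
    have h₁ := norm_sub_norm_le (1 : ℂ) (a * t)
    rw [norm_one, hat] at h₁
    exact h₁
  have hhi : ‖(1 : ℂ) - a * t‖ ≤ 1 + t := by
    have h₁ := norm_sub_le (1 : ℂ) (a * t)
    rw [norm_one, hat] at h₁
    exact h₁
  have hnq : Complex.normSq ((1 : ℂ) - a * t) = ‖(1 : ℂ) - a * t‖ ^ 2 := Complex.normSq_eq_norm_sq _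
  have hsq_lo : (1 - t) ^ 2 ≤ Complex.normSq ((1 : ℂ) - a * t) := by
    rw [hnq]; exact pow_le_pow_left₀ h1t.le hlo 2
  have hsq_hi : Complex.normSq ((1 : ℂ) - a * t) ≤ (1 + t) ^ 2 := by
    rw [hnq]; exact pow_le_pow_left₀ (norm_nonneg _) hhi 2
  have hnq_pos : 0 < Complex.normSq ((1 : ℂ) - a * t) :=
    Complex.normSq_pos.mpr (one_sub_mul_ne_zero ht0 ht1 ha)
  constructor
  · rw [eulerFactor, div_le_div_iff₀ h1t' hnq_pos]
    nlinarith [mul_le_mul_of_nonneg_left hsq_hi h1t.le]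
  · rw [eulerFactor, div_le_div_iff₀ hnq_pos h1t]
    nlinarith [mul_le_mul_of_nonneg_left hsq_lo h1t'.le]

/-- `|I_v(φ⁰_v) − 1| ≤ 4 t_v` at a split unramified place (`0 ≤ t_v ≤ 1/2`, `|a_v| = 1`). -/
theorem abs_eulerFactor_sub_one_le {t : ℝ} (ht0 : 0 ≤ t) (ht : t ≤ 1 / 2) {a : ℂ} (ha : ‖a‖ = 1) :
    |eulerFactor t a - 1| ≤ 4 * t := by
  have ht1 : t < 1 := by linarith
  have h1t : (0 : ℝ) < 1 - t := by linarith
  have h1t' : (0 : ℝ) < 1 + t := by linarith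
  obtain ⟨hlo, hhi⟩ := eulerFactor_bounds ht0 ht1 ha
  have hup : (1 + t) / (1 - t) - 1 ≤ 4 * t := by
    rw [div_sub_one h1t.ne', div_le_iff₀ h1t]
    nlinarith
  have hdown : 1 - (1 - t) / (1 + t) ≤ 4 * t := by
    rw [one_sub_div h1t'.ne', div_le_iff₀ h1t']
    nlinarith
  rw [abs_le]
  constructor <;> linarith

/-! ### The tail `v ∉ S` (tex ll. 628–631): every factor positive, `Σ |log I_v| < ∞`, the product exists -/

section Tail

variable {S : Finset V} {I : V → ℝ} {q : V → ℕ} {a : V → ℂ} {IsSplit : V → Prop}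

/-- The unramified local values of N31g as hypotheses: at split `v ∉ S`,
`I_v = Σ_{n∈ℤ} t_v^{|n|} a_vⁿ` (as a complex series), at non-split `v ∉ S`, `I_v = 1`. -/
structure TailHyps (S : Finset V) (I : V → ℝ) (q : V → ℕ) (a : V → ℂ) (IsSplit : V → Prop) : Prop where
  two_le_q : ∀ v, v ∉ S → 2 ≤ q v
  a_norm : ∀ v, v ∉ S → ‖a v‖ = 1
  split_val : ∀ v, v ∉ S → IsSplit v →
    (I v : ℂ) = ∑' n : ℤ, ((tOf (q v) : ℝ) : ℂ) ^ n.natAbs * a v ^ n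
  nonsplit_val : ∀ v, v ∉ S → ¬IsSplit v → I v = 1

variable (H : TailHyps S I q a IsSplit)
include H

/-- At split `v ∉ S` the factor is the Euler value `(1 − t_v²)/|1 − a_v t_v|²` (the closed form of the series,
PROVED in the package as `Perl34.C4.hasSum_eulerFactor`). -/
theorem tail_split_eq (v : V) (hv : v ∉ S) (hs : IsSplit v) : I v = eulerFactor (tOf (q v)) (a v) :=
  eq_eulerFactor_of_ofReal_eq_tsum (tOf_nonneg (q v)) (tOf_lt_one (H.two_le_q v hv)) (H.a_norm v hv)
    (H.split_val v hv hs)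

/-- Every tail factor is positive. -/
theorem tail_pos (v : V) (hv : v ∉ S) : 0 < I v := by
  by_cases hs : IsSplit v
  · rw [tail_split_eq H v hv hs]
    exact eulerFactor_pos (tOf_nonneg (q v)) (tOf_lt_one (H.two_le_q v hv)) (H.a_norm v hv)
  · rw [H.nonsplit_val v hv hs]
    exact one_pos

/-- `|log I_v| ≤ 4 t_v` on the tail. -/
theorem tail_abs_log_le (v : V) (hv : v ∉ S) : |Real.log (I v)| ≤ 4 * tOf (q v) := by
  by_cases hs : IsSplit v
  · rw [tail_split_eq H v hv hs]
    exact abs_log_eulerFactor_le (tOf_nonneg (q v)) (tOf_le_half (H.two_le_q v hv)) (H.a_norm v hv)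
  · rw [H.nonsplit_val v hv hs, Real.log_one, abs_zero]
    exact mul_nonneg (by norm_num) (tOf_nonneg (q v))

/-- `|I_v − 1| ≤ 4 t_v` on the tail. -/
theorem tail_abs_sub_one_le (v : V) (hv : v ∉ S) : |I v - 1| ≤ 4 * tOf (q v) := by
  by_cases hs : IsSplit v
  · rw [tail_split_eq H v hv hs]
    exact abs_eulerFactor_sub_one_le (tOf_nonneg (q v)) (tOf_le_half (H.two_le_q v hv)) (H.a_norm v hv)
  · rw [H.nonsplit_val v hv hs, sub_self, abs_zero]
    exact mul_nonneg (by norm_num) (tOf_nonneg (q v))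

omit H in
/-- Comparison: `|g_v| ≤ 4 t_v` and `Σ t_v < ∞` on the tail give `Σ |g_v| < ∞`. -/
theorem summable_abs_of_le (hsum : Summable fun v : {w : V // w ∉ S} => tOf (q v.1))
    {g : V → ℝ} (hg : ∀ v, v ∉ S → |g v| ≤ 4 * tOf (q v)) :
    Summable fun v : {w : V // w ∉ S} => |g v.1| :=
  Summable.of_nonneg_of_le (fun _ => abs_nonneg _) (fun v => hg v.1 v.2) (hsum.mul_left 4)

/-- **Absolute convergence of the tail, log form**: `Σ_{v∉S} |log I_v| < ∞`. -/
theorem tail_summable_abs_log (hsum : Summable fun v : {w : V // w ∉ S} => tOf (q v.1)) :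
    Summable fun v : {w : V // w ∉ S} => |Real.log (I v.1)| :=
  summable_abs_of_le hsum (tail_abs_log_le H)

/-- **Absolute convergence of the tail, classical form**: `Σ_{v∉S} |I_v − 1| < ∞`. -/
theorem tail_summable_abs_sub_one (hsum : Summable fun v : {w : V // w ∉ S} => tOf (q v.1)) :
    Summable fun v : {w : V // w ∉ S} => |I v.1 - 1| :=
  summable_abs_of_le hsum (tail_abs_sub_one_le H)

/-- The tail product EXISTS and equals `exp(Σ_{v∉S} log I_v)` (this is the field `AX7_tail` of the prior interface,
now a theorem). -/
theorem tail_hasProd (hsum : Summable fun v : {w : V // w ∉ S} => tOf (q v.1)) :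
    HasProd (fun v : {w : V // w ∉ S} => I v.1)
      (Real.exp (∑' v : {w : V // w ∉ S}, Real.log (I v.1))) :=
  hasProd_of_summable_log (fun v => tail_pos H v.1 v.2) (tail_summable_abs_log H hsum).of_abs

end Tail

/-! ### The full product over all places (tex l. 631: "converges absolutely to a positive number") -/

section Full

variable {S : Finset V} {I : V → ℝ} {q : V → ℕ} {a : V → ℂ} {IsSplit : V → Prop}

/-- The value of the Euler product: finite ramified part times the tail. -/
def eulerValue (S : Finset V) (I : V → ℝ) : ℝ :=
  (∏ v ∈ S, I v) * Real.exp (∑' v : {w : V // w ∉ S}, Real.log (I v.1))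

/-- Every local factor is positive. -/
theorem factor_pos (H : TailHyps S I q a IsSplit) (ram_pos : ∀ v ∈ S, 0 < I v) (v : V) : 0 < I v := by
  by_cases hv : v ∈ S
  · exact ram_pos v hv
  · exact tail_pos H v hv

/-- **`∏_v I_v` converges**: `HasProd I ((∏_{v∈S} I_v) · exp(Σ_{v∉S} log I_v))`. -/
theorem hasProd_eulerValue (H : TailHyps S I q a IsSplit)
    (hsum : Summable fun v : {w : V // w ∉ S} => tOf (q v.1)) : HasProd I (eulerValue S I) := by
  have h1 : HasProd (I ∘ (↑) : (↑S : Set V) → ℝ) (∏ v ∈ S, I v) := S.hasProd I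
  have h2 : HasProd (I ∘ (↑) : ((↑S : Set V)ᶜ : Set V) → ℝ)
      (Real.exp (∑' v : {w : V // w ∉ S}, Real.log (I v.1))) := by
    have h := tail_hasProd H hsum
    exact h
  exact h1.mul_compl h2

/-- (Ported verbatim from the HodgeCMPerL package; no docstring in the source.) -/
theorem multipliable (H : TailHyps S I q a IsSplit)
    (hsum : Summable fun v : {w : V // w ∉ S} => tOf (q v.1)) : Multipliable I :=
  (hasProd_eulerValue H hsum).multipliable

/-- **… to a positive number** (given the ramified positivity `ram_pos` of N31f). -/
theorem eulerValue_pos (ram_pos : ∀ v ∈ S, 0 < I v) : 0 < eulerValue S I :=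
  mul_pos (Finset.prod_pos fun v hv => ram_pos v hv) (Real.exp_pos _)

/-- (Ported verbatim from the HodgeCMPerL package; no docstring in the source.) -/
theorem tprod_eq_eulerValue (H : TailHyps S I q a IsSplit)
    (hsum : Summable fun v : {w : V // w ∉ S} => tOf (q v.1)) : ∏' v, I v = eulerValue S I :=
  (hasProd_eulerValue H hsum).tprod_eq

/-- (Ported verbatim from the HodgeCMPerL package; no docstring in the source.) -/
theorem tprod_pos (H : TailHyps S I q a IsSplit) (ram_pos : ∀ v ∈ S, 0 < I v)
    (hsum : Summable fun v : {w : V // w ∉ S} => tOf (q v.1)) : 0 < ∏' v, I v := by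
  rw [tprod_eq_eulerValue H hsum]
  exact eulerValue_pos ram_pos

/-- **… absolutely (log form)**: `Σ_v |log I_v| < ∞` over ALL places. -/
theorem summable_abs_log (H : TailHyps S I q a IsSplit)
    (hsum : Summable fun v : {w : V // w ∉ S} => tOf (q v.1)) : Summable fun v : V => |Real.log (I v)| :=
  (S.summable_compl_iff (f := fun v : V => |Real.log (I v)|)).mp (tail_summable_abs_log H hsum)

/-- **… absolutely (classical form)**: `Σ_v |I_v − 1| < ∞` over ALL places. -/
theorem summable_abs_sub_one (H : TailHyps S I q a IsSplit)
    (hsum : Summable fun v : {w : V // w ∉ S} => tOf (q v.1)) : Summable fun v : V => |I v - 1| :=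
  (S.summable_compl_iff (f := fun v : V => |I v - 1|)).mp (tail_summable_abs_sub_one H hsum)

end Full

/-! ### Consequences (tex ll. 631–632): `⟨θ_φ(χ'),θ_φ(χ')⟩ > 0`, `θ_φ(χ') ≠ 0`, `π_i ≠ 0` -/

section Consequences

variable {E : Type*} [NormedAddCommGroup E] [InnerProductSpace ℂ E]

/-- A vector whose self-inner-product has positive real part is nonzero. -/
theorem ne_zero_of_inner_self_pos (θ : E) (h : 0 < RCLike.re ⟪θ, θ⟫_ℂ) : θ ≠ 0 := by
  rintro rfl
  simp at h

/-- `θ ≠ 0` and `θ ∈ Θ` give `span Θ ≠ ⊥` ("`π_i ≠ 0`", l. 632: `π_i` is the theta SPACE spanned by the lifts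
`θ(φ, χ'_i)`, tex l. 265–268 / l. 529). -/
theorem span_ne_bot_of_mem {Θ : Set E} {θ : E} (hθ : θ ∈ Θ) (hne : θ ≠ 0) :
    Submodule.span ℂ Θ ≠ ⊥ := by
  intro h
  exact hne ((Submodule.span_eq_bot.mp h) θ hθ)

/-- … and also the CLOSURE of the span is nonzero. -/
theorem closure_span_ne_bot_of_mem {Θ : Set E} {θ : E} (hθ : θ ∈ Θ) (hne : θ ≠ 0) :
    (Submodule.span ℂ Θ).topologicalClosure ≠ ⊥ := by
  intro h
  apply span_ne_bot_of_mem hθ hne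
  exact le_bot_iff.mp (h ▸ Submodule.le_topologicalClosure _)

end Consequences

/-! ### Discharging `Σ_{v∉S} q_v^{−3/2} < ∞` and `q_v ≥ 2` when `V ∖ S` is a set of finite places of a number field -/

section Places

open NumberField IsDedekindDomain

variable (K : Type*) [Field K] [NumberField K] {S : Finset V} {q : V → ℕ}
  (e : {w : V // w ∉ S} → HeightOneSpectrum (𝓞 K)) (he : Function.Injective e)
  (hq : ∀ v : {w : V // w ∉ S}, q v.1 = Ideal.absNorm (e v).asIdeal)
include he hq

/-- If the places outside `S` are (injectively) finite places `v` of the number field `K = L₀` with `q_v = N(v)`,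
then `Σ_{v∉S} q_v^{−3/2} < ∞` — by `NumberField.summable_absNorm_rpow` (companion file). -/
theorem summable_tOf_of_places : Summable fun v : {w : V // w ∉ S} => tOf (q v.1) := by
  have h := (summable_absNorm_rpow_neg_three_halves K).comp_injective he
  refine h.congr fun v => ?_
  simp only [Function.comp_apply, tOf, hq v]

omit he in
/-- … and `q_v ≥ 2`. -/
theorem two_le_of_places (v : V) (hv : v ∉ S) : 2 ≤ q v := by
  have h := hq ⟨v, hv⟩
  simp only at h
  rw [h]
  exact two_le_absNorm K (e ⟨v, hv⟩)

end Places

/-! ### The node as ONE datum: the local-factor datum of a chosen `φ = ⊗φ_v` and character `χ'` -/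


-- port_pkg: scope closed for this part
end EulerProduct
end PerL34
end HodgeCM
end
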